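import Summits.Ventures.Crystal3D.Bulk.RotSysFaceGlue
import Summits.Ventures.Crystal3D.Bulk.RotSysBridge
import HarnessLib

/-!
# Combinatorial Gauss–Bonnet for weighted planar rotation systems: faces of CONNECTED sub-maps
# have nonnegative excess, and a sub-map all of whose corners are `< π` is connected
# (the abstract form of P-L3(b) L1, `phase2/LEAN-FACES-DESIGN.md` §5.6 (i))

HONEST FRAMING. Part of the venture `Summits/Ventures/Crystal3D` (cell `pub-crystal3d`, phase 2;
seat p3), PURELY COMBINATORIAL and generic (folklore): no geometry. Setting: a loopless rotation
system `(σ, α)` on a finite dart type with weights `w` (`Bulk/RotSysCorners.lean`), which is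
PLANAR (`chi2 univ = 4·numK univ`) and CONNECTED (`conn univ x y` for all darts), whose full
faces have nonnegative excess (`0 ≤ excess univ x`: for a triangulation of the sphere by
geodesic triangles, "angle sum ≥ π") and whose vertices weigh at most a full turn
(`cornerAt σ w {z} z ≤ 2π`). Then:

* **Theorem A, `IsRotSys.excess_nonneg_of_numK_eq_one`** — every face of every CONNECTED
  `α`-closed sub-map `S` has excess `≥ 0`. Induction on `#(univ ∖ S)`: add an ambient edge `e`
  with an end at a vertex of `S` (`exists_dart_out`, `Bulk/RotSysBridge.lean`); by `Bulk/RotSysFaceGlue.lean` a face of `S`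
  is a face of `S ∪ e` (same excess), or splits into two faces of `S ∪ e` (excess = sum), or
  absorbs a pendant edge (excess changes by `2π − (vertex weight) ≥ 0`); two DIFFERENT faces of
  `S` cannot merge in `S ∪ e` — that would drop `χ` by `2` while both maps are connected and
  planar (`RotSys.IsRotSys.chi2_eq_of_subset`);
* **Theorem B, `IsRotSys.numK_eq_one_of_cornerAt_lt_pi`** — an `α`-closed nonempty sub-map `T`
  all of whose corners are `< π` is CONNECTED (`numK T = 1`). If not, grow `T` by ambient edges
  leaving a component (`exists_bridge_dart`): an edge into a bare vertex keeps every face excess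
  `< 2π`; an edge into ANOTHER component glues two faces of excess `< 2π` each into one of excess
  `< 2π + 2π − 4π = 0`, which survives (only decreasing) until the map is connected —
  contradicting Theorem A.

This is the combinatorial core of «every face of the tight graph is a disc, hence T′ is
connected» (Gauss–Bonnet with exterior angles `> 0`); the instantiation for the hull fan
triangulation of a GAP configuration is in `Bulk/HullRotSysAngles.lean` /
`Bulk/GapTightConnected.lean`. Nothing here mentions GAP(1.26).
-/

namespace Summit.Ventures.Crystal3D

namespace RotSys

open Equiv Equiv.Perm Finset

open scoped Classical

variable {D : Type*} [DecidableEq D] [Fintype D] {σ α : Perm D}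

/-! ## Theorem A: faces of connected sub-maps have nonnegative excess -/

section GaussBonnet

variable (h : IsRotSys σ α) (w : D → ℝ)
  (hplanar : chi2 σ α univ = 4 * (numK σ α univ : ℤ))
  (hconn : ∀ x y : D, conn σ α univ x y)
  (hface : ∀ x : D, 0 ≤ excess σ α w univ x)
  (hvert : ∀ z : D, cornerAt σ w {z} z ≤ 2 * Real.pi)
include h hplanar hconn hface hvert

/-- Theorem A in induction form (on the number of ambient darts outside `S`). -/
theorem IsRotSys.excess_nonneg_aux :
    ∀ (n : ℕ) (S : Finset D), (univ \ S).card = n → IsClosed α S → numK σ α S = 1 →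
      ∀ x ∈ S, 0 ≤ excess σ α w S x := by
  intro n
  induction n using Nat.strong_induction_on with
  | _ n ih =>
    intro S hn hS hK x hx
    by_cases hSu : S = univ
    · subst hSu; exact hface x
    -- an ambient edge `{z, α z}` out of `S`, with `z` at the vertex of `x' ∈ S`
    obtain ⟨y, hy⟩ : ∃ y, y ∉ S := by
      by_contra hall
      push Not at hall
      exact hSu (eq_univ_iff_forall.2 hall)
    obtain ⟨z, hzS, x', hx'S, hzx'⟩ := h.exists_dart_out hconn hS hx hy
    have hαzS : α z ∉ S := fun hmem => hzS (by have := hS _ hmem; rwa [h.α_inv] at this)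
    obtain ⟨S', hS'def⟩ : ∃ S' : Finset D, S' = S ∪ {z, α z} := ⟨_, rfl⟩
    have hS'c : IsClosed α S' := by rw [hS'def]; exact h.isClosed_union_pair hS z
    have hzS' : z ∈ S' := by rw [hS'def]; simp
    have hsub : S ⊆ S' := by rw [hS'def]; exact subset_union_left
    have hx'S' : x' ∈ S' := hsub hx'S
    have hSd : S' \ {z, α z} = S := by rw [hS'def]; exact h.union_pair_sdiff hS hzS
    have hlt : (univ \ S').card < n := by rw [← hn, hS'def]; exact card_univ_sdiff_union_pair_lt hzS
    have hx'z : x' ≠ z := fun e => hzS (e ▸ hx'S)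
    have hx'αz : x' ≠ α z := fun e => hαzS (e ▸ hx'S)
    -- `S'` is still connected
    have hK' : numK σ α S' = 1 := by
      refine le_antisymm ?_ (numClasses_pos _ ⟨z, hzS'⟩)
      have hle := h.numK_le_numK_sdiff_add hS'c hzS'
      rw [hSd, hK, if_pos ⟨x', hx'S', hx'z, hx'αz, conn_of_sameCycle hzS' hx'S' hzx'⟩] at hle
      exact hle
    have hall' : ∀ x'' ∈ S', 0 ≤ excess σ α w S' x'' := ih _ hlt S' rfl hS'c hK'
    -- `z` is not alone at its vertex
    have hnd : induce σ S' z ≠ z := induce_ne_self_of_mem_cycle σ hzS' hx'S' hx'z hzx'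
    have hxS0 : x ∈ S' \ {z, α z} := by rw [hSd]; exact hx
    rw [← hSd]
    by_cases hD0 : ¬ (phi σ α S').SameCycle z x ∧ ¬ (phi σ α S').SameCycle (α z) x
    · -- a face away from the new edge
      rw [h.excess_sdiff_of_not_sameCycle hS'c hzS' w (hsub hx) hD0.1 hD0.2]
      exact hall' x (hsub hx)
    have hxU : x ∈ (face σ α S' z ∪ face σ α S' (α z)) \ {z, α z} := by
      rw [mem_U_iff]
      refine ⟨hxS0, ?_⟩
      by_contra hor
      push Not at hor
      exact hD0 hor
    by_cases hsame : (phi σ α S').SameCycle z (α z)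
    · by_cases hpend : induce σ S' (α z) = α z
      · -- the new edge is pendant at `α z`
        rw [h.excess_sdiff_pendant hS'c hzS' w hpend hnd hxU]
        have := hall' z hzS'
        have := hvert (α z)
        linarith
      · -- both ends meet the map and the ends lie on ONE face of `S'`: impossible (χ drops)
        exfalso
        have hφ1 : ¬ phi σ α S' (α z) = z := by rw [phi_apply, h.α_inv]; exact hnd
        have hφ2 : ¬ phi σ α S' z = α z := by rw [phi_apply]; exact hpend
        have hF := h.numF_sdiff_split hS'c hzS' hsame
        have hV := h.numV_sdiff hS'c hzS'
        have hE := h.card_sdiff hS'c hzS'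
        rw [if_neg hφ1, if_neg hφ2, hSd] at hF
        rw [if_neg hφ1, if_neg hφ2, hSd] at hV
        rw [hSd] at hE
        have hc := h.chi2_eq_of_planar hplanar hS
        have hc' := h.chi2_eq_of_planar hplanar hS'c
        unfold chi2 at hc hc'
        rw [hK] at hc
        rw [hK'] at hc'
        push_cast at hc hc'
        omega
    · -- the face of `x` splits into the faces of `z` and `α z`
      rw [h.excess_sdiff_merge hS'c hzS' w hsame hxU]
      have := hall' z hzS'
      have := hall' (α z) (hS'c z hzS')
      linarith

/-- **Theorem A (combinatorial Gauss–Bonnet, lower bound).** In a connected planar weighted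
rotation system whose full faces have nonnegative excess and whose vertices weigh `≤ 2π`, every
face of every CONNECTED `α`-closed sub-map has nonnegative excess. -/
theorem IsRotSys.excess_nonneg_of_numK_eq_one {S : Finset D} (hS : IsClosed α S)
    (hK : numK σ α S = 1) {x : D} (hx : x ∈ S) : 0 ≤ excess σ α w S x :=
  h.excess_nonneg_aux w hplanar hconn hface hvert _ S rfl hS hK x hx

/-! ## Theorem B: corners `< π` force connectedness -/

/-- Theorem B in induction form. The invariant of the growing set `S ⊇ T`: every face has
excess `< 2π`, and once a component has been merged some face has excess `< 0`. -/
theorem IsRotSys.numK_eq_one_aux {T : Finset D} (hKT : 2 ≤ numK σ α T) (hTne : T.Nonempty) :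
    ∀ (n : ℕ) (S : Finset D), (univ \ S).card = n → IsClosed α S → T ⊆ S →
      (∀ x ∈ S, excess σ α w S x < 2 * Real.pi) →
      (numK σ α S < numK σ α T → ∃ x ∈ S, excess σ α w S x < 0) → False := by
  intro n
  induction n using Nat.strong_induction_on with
  | _ n ih =>
    intro S hn hS hTS hI1 hI2
    have hSne : S.Nonempty := hTne.mono hTS
    by_cases hK : numK σ α S = 1
    · obtain ⟨x, hx, hneg⟩ := hI2 (by omega)
      have := h.excess_nonneg_of_numK_eq_one w hplanar hconn hface hvert hS hK hx
      linarith
    -- an ambient edge `{z, α z}` leaving the component of `x`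
    obtain ⟨x, hx, y, hy, hxy⟩ := exists_not_conn_of_numK_ne_one hSne hK
    obtain ⟨z, hzS, ⟨x', hx'S, hxx', hzx'⟩, hfar⟩ := h.exists_bridge_dart hconn hS hx hy hxy
    have hαzS : α z ∉ S := fun hmem => hzS (by have := hS _ hmem; rwa [h.α_inv] at this)
    obtain ⟨S', hS'def⟩ : ∃ S' : Finset D, S' = S ∪ {z, α z} := ⟨_, rfl⟩
    have hS'c : IsClosed α S' := by rw [hS'def]; exact h.isClosed_union_pair hS z
    have hzS' : z ∈ S' := by rw [hS'def]; simp
    have hαzS' : α z ∈ S' := hS'c z hzS'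
    have hsub : S ⊆ S' := by rw [hS'def]; exact subset_union_left
    have hx'S' : x' ∈ S' := hsub hx'S
    have hSd : S' \ {z, α z} = S := by rw [hS'def]; exact h.union_pair_sdiff hS hzS
    have hlt : (univ \ S').card < n := by rw [← hn, hS'def]; exact card_univ_sdiff_union_pair_lt hzS
    have hx'z : x' ≠ z := fun e => hzS (e ▸ hx'S)
    have hmemS' : ∀ {v}, v ∈ S' ↔ v ∈ S ∨ v = z ∨ v = α z := by
      intro v; rw [hS'def, mem_union, mem_insert, mem_singleton]
    -- `z` is not alone at its vertex; the successor of `α z`'s position is in the component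
    have hnd : induce σ S' z ≠ z := induce_ne_self_of_mem_cycle σ hzS' hx'S' hx'z hzx'
    have hq₂S : induce σ S' z ∈ S := by
      have h1 : induce σ S' z ∈ S' \ {z, α z} :=
        mem_sdiff_pair_iff.2 ⟨induce_apply_mem σ hzS', hnd, h.induce_ne_alpha S' z⟩
      rwa [hSd] at h1
    have hq₂conn : conn σ α S x (induce σ S' z) :=
      conn_trans hxx' (conn_of_sameCycle hx'S hq₂S
        (hzx'.symm.trans (sameCycle_induce_apply σ S' z)))
    -- the two ends lie on ONE face of `S'` (else a face of `S` would join the two sides)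
    have hsame : (phi σ α S').SameCycle z (α z) := by
      by_contra hdiff
      -- `q₁ = φ z` is a dart of `S` at the vertex of `α z`; `q₂ = φ (α z)` one at the vertex of `z`
      have hq₁S : phi σ α S' z ∈ S := by
        have h1 : phi σ α S' z ∈ S' \ {z, α z} := by
          refine mem_sdiff_pair_iff.2 ⟨phi_apply_mem hS'c hzS', h.phi_ne_self S' z, fun e => ?_⟩
          exact hdiff ⟨1, by rw [zpow_one, e]⟩
        rwa [hSd] at h1
      have hq₁cyc : σ.SameCycle (α z) (phi σ α S' z) := by
        rw [phi_apply]; exact sameCycle_induce_apply σ S' (α z)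
      have hq₁U : phi σ α S' z ∈ (face σ α S' z ∪ face σ α S' (α z)) \ {z, α z} := by
        rw [mem_U_iff, hSd]; exact ⟨hq₁S, Or.inl ⟨1, by rw [zpow_one]⟩⟩
      have hq₂eq : phi σ α S' (α z) = induce σ S' z := by rw [phi_apply, h.α_inv]
      have hq₂U : phi σ α S' (α z) ∈ (face σ α S' z ∪ face σ α S' (α z)) \ {z, α z} := by
        rw [mem_U_iff, hSd, hq₂eq]
        refine ⟨hq₂S, Or.inr ?_⟩
        rw [← hq₂eq]
        exact ⟨1, by rw [zpow_one]⟩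
      have hF := h.face_sdiff_eq_U_of_merge hS'c hzS' hdiff hq₁U
      have h12 : (phi σ α (S' \ {z, α z})).SameCycle (phi σ α S' z) (phi σ α S' (α z)) := by
        have : phi σ α S' (α z) ∈ face σ α (S' \ {z, α z}) (phi σ α S' z) := by rw [hF]; exact hq₂U
        exact (mem_face.1 this).2
      rw [hSd] at h12
      have hc12 : conn σ α S (phi σ α S' z) (phi σ α S' (α z)) := conn_of_sameCycle_phi hS hq₁S h12
      rw [hq₂eq] at hc12
      exact hfar _ hq₁S hq₁cyc (conn_trans hq₂conn (conn_symm hc12))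
    -- faces of `S'` away from the edge are faces of `S`
    have hD0 : ∀ v ∈ S', ¬ ((phi σ α S').SameCycle z v ∨ (phi σ α S').SameCycle (α z) v) →
        v ∈ S ∧ excess σ α w S' v = excess σ α w S v := by
      intro v hv hno
      push Not at hno
      have hvS : v ∈ S := by
        rcases hmemS'.1 hv with hvS | rfl | rfl
        · exact hvS
        · exact absurd (SameCycle.refl _ _) hno.1
        · exact absurd (SameCycle.refl _ _) hno.2
      refine ⟨hvS, ?_⟩
      rw [← hSd]
      exact (h.excess_sdiff_of_not_sameCycle hS'c hzS' w hv hno.1 hno.2).symm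
    -- faces of `S'` through `z` or `α z` have the excess of the face of `z`
    have hmemcyc : ∀ {u v : D}, u ∈ S' → (phi σ α S').SameCycle u v → v ∈ S' := by
      intro u v hu hc
      obtain ⟨k, hk⟩ := hc.exists_nat_pow_eq
      rw [← hk]; exact phi_pow_apply_mem hS'c hu k
    have hDz : ∀ v, ((phi σ α S').SameCycle z v ∨ (phi σ α S').SameCycle (α z) v) →
        excess σ α w S' v = excess σ α w S' z := by
      intro v hv
      have hvF : v ∈ face σ α S' z := by
        rcases hv with hv | hv
        · exact mem_face.2 ⟨hmemcyc hzS' hv, hv⟩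
        · rw [face_eq_of_sameCycle hsame]
          exact mem_face.2 ⟨hmemcyc hαzS' hv, hv⟩
      exact excess_eq_of_mem_face w hvF
    by_cases hb : ∃ y' ∈ S, σ.SameCycle (α z) y'
    · -- (i) the far end meets the map: two faces of `S` glue into ONE face of excess `< 0`
      obtain ⟨y', hy'S, hy'c⟩ := hb
      have hy'α : y' ≠ α z := fun e => hαzS (e ▸ hy'S)
      have hnα : induce σ S' (α z) ≠ α z :=
        induce_ne_self_of_mem_cycle σ hαzS' (hsub hy'S) hy'α hy'c
      have hU₁ne : ((face σ α S' z ∪ face σ α S' (α z)) \ {z, α z}).filter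
          (fun y => (nu σ α S' z).SameCycle z y) ≠ ∅ :=
        fun e => hnα ((h.U₁_eq_empty_iff hS'c hzS').1 e)
      have hU₂ne : ((face σ α S' z ∪ face σ α S' (α z)) \ {z, α z}).filter
          (fun y => (nu σ α S' z).SameCycle (α z) y) ≠ ∅ :=
        fun e => hnd ((h.U₂_eq_empty_iff hS'c hzS').1 e)
      obtain ⟨q₁, hq₁⟩ := Finset.nonempty_iff_ne_empty.2 hU₁ne
      obtain ⟨q₂, hq₂⟩ := Finset.nonempty_iff_ne_empty.2 hU₂ne
      rw [mem_filter] at hq₁ hq₂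
      have hsplit := h.excess_sdiff_split hS'c hzS' w hsame hq₁.1 hq₁.2 hq₂.1 hq₂.2
      rw [hSd] at hsplit
      have hq₁S : q₁ ∈ S := by have := (mem_U_iff.1 hq₁.1).1; rwa [hSd] at this
      have hq₂S : q₂ ∈ S := by have := (mem_U_iff.1 hq₂.1).1; rwa [hSd] at this
      have hneg : excess σ α w S' z < 0 := by
        have := hI1 q₁ hq₁S
        have := hI1 q₂ hq₂S
        linarith
      refine ih _ hlt S' rfl hS'c (hTS.trans hsub) ?_ ?_
      · intro v hv
        by_cases hc : (phi σ α S').SameCycle z v ∨ (phi σ α S').SameCycle (α z) v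
        · rw [hDz v hc]; linarith [Real.pi_pos]
        · obtain ⟨hvS, he⟩ := hD0 v hv hc
          rw [he]; exact hI1 v hvS
      · intro; exact ⟨z, hzS', hneg⟩
    · -- (ii) the far end is a bare vertex: the new edge is pendant at `α z`
      have hpend : induce σ S' (α z) = α z := by
        rw [induce_apply_eq_self_iff σ hαzS']
        intro y' hy' hc
        rcases hmemS'.1 hy' with hy'S | rfl | rfl
        · exact absurd ⟨y', hy'S, hc⟩ hb
        · exact absurd hc.symm (h.loopless _)
        · rfl
      have hq₂U : induce σ S' z ∈ (face σ α S' z ∪ face σ α S' (α z)) \ {z, α z} := by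
        rw [mem_U_iff, hSd]
        refine ⟨hq₂S, Or.inr ⟨1, ?_⟩⟩
        rw [zpow_one, phi_apply, h.α_inv]
      have hpq : ∀ q ∈ (face σ α S' z ∪ face σ α S' (α z)) \ {z, α z},
          excess σ α w S q = excess σ α w S' z - cornerAt σ w {α z} (α z) + 2 * Real.pi := by
        intro q hq
        have := h.excess_sdiff_pendant hS'c hzS' w hpend hnd hq
        rwa [hSd] at this
      have hzle : excess σ α w S' z ≤ excess σ α w S (induce σ S' z) := by
        rw [hpq _ hq₂U]
        have := hvert (α z)
        linarith
      refine ih _ hlt S' rfl hS'c (hTS.trans hsub) ?_ ?_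
      · intro v hv
        by_cases hc : (phi σ α S').SameCycle z v ∨ (phi σ α S').SameCycle (α z) v
        · rw [hDz v hc]; exact lt_of_le_of_lt hzle (hI1 _ hq₂S)
        · obtain ⟨hvS, he⟩ := hD0 v hv hc
          rw [he]; exact hI1 v hvS
      · intro hlt'
        -- the component count did not change
        have hKle : numK σ α S ≤ numK σ α S' := by
          have h1 := h.numK_sdiff_le_of_alone hS'c hzS' (Or.inl (by rw [phi_apply, hpend]))
          have h2 := h.numClasses_conn_sdiff hS'c hzS'
          rw [hSd] at h1 h2
          have h3 : numClasses (conn σ α S') S ≤ numK σ α S' := by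
            rw [← h2]; exact Nat.le_add_right _ _
          exact h1.trans h3
        obtain ⟨x₀, hx₀S, hx₀neg⟩ := hI2 (lt_of_le_of_lt hKle hlt')
        by_cases hc : (phi σ α S').SameCycle z x₀ ∨ (phi σ α S').SameCycle (α z) x₀
        · refine ⟨z, hzS', ?_⟩
          have hx₀U : x₀ ∈ (face σ α S' z ∪ face σ α S' (α z)) \ {z, α z} := by
            rw [mem_U_iff, hSd]; exact ⟨hx₀S, hc⟩
          have := hpq x₀ hx₀U
          have := hvert (α z)
          linarith
        · obtain ⟨-, he⟩ := hD0 x₀ (hsub hx₀S) hc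
          exact ⟨x₀, hsub hx₀S, by rw [he]; exact hx₀neg⟩

/-- **Theorem B (corners `< π` force connectedness).** In a connected planar weighted rotation
system whose full faces have nonnegative excess and whose vertices weigh `≤ 2π`, an `α`-closed
nonempty sub-map all of whose corners are `< π` is CONNECTED. -/
theorem IsRotSys.numK_eq_one_of_cornerAt_lt_pi {T : Finset D} (hT : IsClosed α T)
    (hTne : T.Nonempty) (hlt : ∀ z ∈ T, cornerAt σ w T z < Real.pi) : numK σ α T = 1 := by
  by_contra hK1
  have hpos : 0 < numK σ α T := numClasses_pos _ hTne
  have hKT : 2 ≤ numK σ α T := by omega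
  exact h.numK_eq_one_aux w hplanar hconn hface hvert hKT hTne _ T rfl hT Subset.rfl
    (fun x hx => excess_lt_two_pi_of_cornerAt_lt w hT hlt hx) (fun hh => absurd hh (lt_irrefl _))

end GaussBonnet

end RotSys

end Summit.Ventures.Crystal3D
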